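import Summits.NavierStokesRegularity.NavierStokesRegularity.Theorems.EfficiencyFloorNearSaturationNearMaximiserSeqCoreUpgrade
import Summits.NavierStokesRegularity.NavierStokesRegularity.Theorems.EfficiencyFloorEfficiencyConcentration
import HarnessLib

/-!
# Route `EfficiencyFloor`, crux `NearSaturationNearMaximiser` (stmt-NavierStokesRegularity-25482) on the
# `ProductionEfficiencyDecay` ladder (stmt-22866): NON-VANISHING — centring normalised maximising sequences by
# `EfficiencyConcentration` — and compactness from weak profiles of CENTRED sequences

Def-free helper file, companion of `…SeqCoreUpgrade` (moves (N), (P), (U) of the concentration-compactness step for the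
Lu–Doering functional are described there). This file PROVES move (N) outright and composes it with (U):

* §4 `setIntegral_ball_comp_sub`, `exists_centres_of_maximising` — (N): for `c > 0` there are `K, δ > 0` such that every
  admissible sequence with `Z = Pal = 1` and `S → c` admits translates whose enstrophy in the FIXED ball `B(0, K)` is
  eventually at least `δ` — by the landed item `EfficiencyConcentration` (stmt-23111,
  `efficiencyFloor_efficiencyConcentration_proof`) at efficiency `c/2`, whose concentration scale `(Z/Pal)^{1/2}` equals `1`
  at `Z = Pal = 1`.
* §5 `compact_of_centredWeakProfile` — (N) and (U) composed: it suffices to produce the weak profile of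
  `compact_of_weakProfile` for CENTRED normalised maximising sequences (eventually `δ ≤ ∫_{B(0,K)}|curl v_n|²`), for all
  `K, δ > 0`.
* §6 `sqrt_setIntegral_curl_sq_le`, `enstrophy_pos_of_centred_localLimit`, `compact_of_centredLocalProfile`,
  `nearSaturationNearMaximiser_of_centredLocalProfile` — the non-vanishing OF THE LIMIT, proved: a centred sequence
  converging locally on the centring ball (`∫_{B(0,K)}|curl(v_k − w)|² → 0`, Rellich's output) has a limit with
  `δ ≤ ∫_{B(0,K)}|curl w|²`, so `0 < Z(w)`; hence the weak-profile hypothesis may drop its non-vanishing clause and its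
  translates: BY NAME, stmt-25482 ⟸ (P_loc) = «centred normalised maximising sequences have a subsequence and an
  admissible limit with local vorticity convergence on `B(0,K)`, asymptotic Pythagoras for `Z`, `Pal`, splitting of `S`».

WHAT REMAINS of COMPACTNESS(`c⋆`) after these two files is exactly the middle move (P), for CENTRED sequences (hypothesis
`HWloc` of §6, stated in Lean): local compactness of admissible fields with `Z = Pal = 1` on the ball `B(0, K)` (Rellich),
a weak limit in `Ḣ¹ ∩ Ḣ²` with the asymptotic Pythagoras identities (Banach–Alaoglu + Hilbert structure), the splitting of
the cubic functional `S` (Brezis–Lieb type), and admissibility (smoothness, `L²`) of the limit — the regularity of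
Lu–Doering extremisers. HONEST FRAMING: stmt-25482, `LerayFloorGap`, `ProductionEfficiencyDecay`
(stmt-22866) and Navier–Stokes regularity stay OPEN; no summit statement is proved. [folklore]
-/

-- the problem directory repeats the summit name (`NavierStokesRegularity/NavierStokesRegularity`)
set_option linter.dupNamespace false

noncomputable section

namespace Summit.NavierStokesRegularity.NavierStokesRegularity.Theorems

namespace NearSaturationNearMaximiser

namespace SeqCore

open Set MeasureTheory Filter Topology Function
open scoped InnerProductSpace ENNReal
open Literature.Analysis.FluidPDE
open RigidExit.Resonance

/-! ## §4 Non-vanishing: centring a maximising sequence by `EfficiencyConcentration` -/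

/-- Set integral over a ball of a translate: `∫_{B(0,K)} F(x − a) dx = ∫_{B(−a,K)} F`. [folklore] -/
theorem setIntegral_ball_comp_sub (F : EuclideanSpace ℝ (Fin 3) → ℝ) (a : EuclideanSpace ℝ (Fin 3)) (K : ℝ) :
    ∫ x in Metric.ball (0 : EuclideanSpace ℝ (Fin 3)) K, F (x - a) = ∫ y in Metric.ball (-a) K, F y := by
  have hpre : (fun x : EuclideanSpace ℝ (Fin 3) => x - a) ⁻¹' Metric.ball (-a) K =
      Metric.ball (0 : EuclideanSpace ℝ (Fin 3)) K := by
    ext x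
    simp only [mem_preimage, Metric.mem_ball, dist_eq_norm, sub_neg_eq_add, sub_add_cancel, sub_zero]
  rw [← hpre]
  exact (measurePreserving_sub_right (volume : Measure (EuclideanSpace ℝ (Fin 3))) a).setIntegral_preimage_emb
    (measurableEmbedding_subRight a) F (Metric.ball (-a) K)

/-- **NON-VANISHING (centring), proved.** For `c > 0` there are `K, δ > 0` such that every admissible sequence normalised to
`Z = Pal = 1` with `S(v_n) → c` admits translates `v_n(· − a_n)` whose enstrophy in the FIXED ball `B(0, K)` is eventually at
least `δ`: by the landed `EfficiencyConcentration` (stmt-23111) at efficiency `c/2` (eventually `S(v_n) ≥ c/2 = (c/2)·Z^{3/4}Pal^{3/4}`),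
whose concentration radius `K (Z/Pal)^{1/2}` equals `K` at `Z = Pal = 1`. This is the «no vanishing» input of the
concentration-compactness step. [folklore] -/
theorem exists_centres_of_maximising {c : ℝ} (hc : 0 < c) :
    ∃ K δ : ℝ, 0 < K ∧ 0 < δ ∧ ∀ v : ℕ → EuclideanSpace ℝ (Fin 3) → EuclideanSpace ℝ (Fin 3), (∀ n, ContDiff ℝ (⊤ : ℕ∞) (v n) ∧
      Literature.Analysis.FluidPDE.VectorCalculus.IsDivFree (v n) ∧ (∫⁻ x, ‖iteratedFDeriv ℝ 0 (v n) x‖ₑ ^ 2 < ⊤) ∧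
      (∫⁻ x, ‖iteratedFDeriv ℝ 1 (v n) x‖ₑ ^ 2 < ⊤) ∧ (∫⁻ x, ‖iteratedFDeriv ℝ 2 (v n) x‖ₑ ^ 2 < ⊤)) →
      (∀ n, (∫ x, ‖Literature.Analysis.FluidPDE.curl (v n) x‖ ^ 2) = 1) →
      (∀ n, (∫ x, Literature.Analysis.FluidPDE.frobeniusNormSq (fderiv ℝ (Literature.Analysis.FluidPDE.curl (v n)) x)) = 1) →
      Tendsto (fun n => ∫ x, ⟪Literature.Analysis.FluidPDE.curl (v n) x, fderiv ℝ (v n) x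
        (Literature.Analysis.FluidPDE.curl (v n) x)⟫_ℝ) atTop (𝓝 c) →
      ∃ a : ℕ → EuclideanSpace ℝ (Fin 3), ∀ᶠ n in atTop,
        δ ≤ ∫ x in Metric.ball (0 : EuclideanSpace ℝ (Fin 3)) K, ‖Literature.Analysis.FluidPDE.curl (fun x => v n (x - a n)) x‖ ^ 2 := by
  obtain ⟨K, δ, hK, hδ, H⟩ := efficiencyFloor_efficiencyConcentration_proof (c / 2) (half_pos hc)
  refine ⟨K, δ, hK, hδ, fun v hAdm hZ1 hP1 hS => ?_⟩
  have hev : ∀ᶠ n in atTop, c / 2 ≤ ∫ x, ⟪curl (v n) x, fderiv ℝ (v n) x (curl (v n) x)⟫_ℝ :=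
    hS.eventually_const_le (half_lt_self hc)
  have hcentre : ∀ n, c / 2 ≤ (∫ x, ⟪curl (v n) x, fderiv ℝ (v n) x (curl (v n) x)⟫_ℝ) →
      ∃ b : EuclideanSpace ℝ (Fin 3), δ ≤ ∫ x in Metric.ball b K, ‖curl (v n) x‖ ^ 2 := by
    intro n hn
    have h := H (v n) (hAdm n).1 (hAdm n).2.1 (hAdm n).2.2.1 (hAdm n).2.2.2.1 (hAdm n).2.2.2.2
      (by rw [hZ1 n]; exact one_pos) (by rw [hP1 n]; exact one_pos)
      (by rw [hZ1 n, hP1 n, Real.one_rpow, mul_one, mul_one]; exact hn)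
    rw [hZ1 n, hP1 n, div_one, Real.sqrt_one, mul_one, mul_one] at h
    exact h
  classical
  set a : ℕ → EuclideanSpace ℝ (Fin 3) := fun n =>
    if hn : c / 2 ≤ (∫ x, ⟪curl (v n) x, fderiv ℝ (v n) x (curl (v n) x)⟫_ℝ) then -(hcentre n hn).choose else 0 with ha_def
  have ha : ∀ n (hn : c / 2 ≤ (∫ x, ⟪curl (v n) x, fderiv ℝ (v n) x (curl (v n) x)⟫_ℝ)), a n = -(hcentre n hn).choose := by
    intro n hn
    rw [ha_def]
    exact dif_pos hn
  refine ⟨a, hev.mono fun n hn => ?_⟩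
  have hb := (hcentre n hn).choose_spec
  have hcurl : ∀ x, curl (fun y => v n (y - a n)) x = curl (v n) (x - a n) := fun x => curl_comp_sub_const (v n) _ x
  simp_rw [hcurl]
  rw [setIntegral_ball_comp_sub (fun y => ‖curl (v n) y‖ ^ 2) (a n) K, ha n hn, neg_neg]
  exact hb

/-! ## §5 Compactness from a weak profile of CENTRED sequences only -/

/-- Composition of translates (plumbing): `(x ↦ u(x − b))` with `u = v(· − a)` is `v(· − (b + a))`. [folklore] -/
theorem translate_translate (v : EuclideanSpace ℝ (Fin 3) → EuclideanSpace ℝ (Fin 3)) (a b : EuclideanSpace ℝ (Fin 3)) :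
    (fun x => (fun y => v (y - a)) (x - b)) = fun x => v (x - (b + a)) := by
  funext x
  simp only [sub_sub]

/-- **COMPACTNESS from weak profiles of CENTRED sequences.** By §4 it suffices to produce the weak profile of §2 for
admissible sequences with `Z = Pal = 1`, `S → c` that are moreover CENTRED: eventually `δ ≤ ∫_{B(0,K)} |curl v_n|²` for
some fixed `K, δ > 0` (then local compactness on `B(0, K)` makes the weak limit nonzero). Formally: if for all `K, δ > 0`
every centred normalised sequence with `S → c` has a weak profile, then COMPACTNESS at `c` holds (`c > 0` admissible). [folklore] -/
theorem compact_of_centredWeakProfile {c : ℝ} (hc : 0 < c)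
    (hadm : ∀ f : EuclideanSpace ℝ (Fin 3) → EuclideanSpace ℝ (Fin 3), (ContDiff ℝ (⊤ : ℕ∞) f ∧
      Literature.Analysis.FluidPDE.VectorCalculus.IsDivFree f ∧ (∫⁻ x, ‖iteratedFDeriv ℝ 0 f x‖ₑ ^ 2 < ⊤) ∧
      (∫⁻ x, ‖iteratedFDeriv ℝ 1 f x‖ₑ ^ 2 < ⊤) ∧ (∫⁻ x, ‖iteratedFDeriv ℝ 2 f x‖ₑ ^ 2 < ⊤)) → (∫ x,
      ⟪Literature.Analysis.FluidPDE.curl f x, fderiv ℝ f x (Literature.Analysis.FluidPDE.curl f x)⟫_ℝ) ≤ c *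
      (∫ x, ‖Literature.Analysis.FluidPDE.curl f x‖ ^ 2) ^ (3 / 4 : ℝ) * (∫ x,
      Literature.Analysis.FluidPDE.frobeniusNormSq (fderiv ℝ (Literature.Analysis.FluidPDE.curl f) x)) ^ (3 / 4 : ℝ))
    (HWc : ∀ K δ : ℝ, 0 < K → 0 < δ → ∀ v : ℕ → EuclideanSpace ℝ (Fin 3) → EuclideanSpace ℝ (Fin 3),
      (∀ n, ContDiff ℝ (⊤ : ℕ∞) (v n) ∧
      Literature.Analysis.FluidPDE.VectorCalculus.IsDivFree (v n) ∧ (∫⁻ x, ‖iteratedFDeriv ℝ 0 (v n) x‖ₑ ^ 2 < ⊤) ∧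
      (∫⁻ x, ‖iteratedFDeriv ℝ 1 (v n) x‖ₑ ^ 2 < ⊤) ∧ (∫⁻ x, ‖iteratedFDeriv ℝ 2 (v n) x‖ₑ ^ 2 < ⊤)) →
      (∀ n, (∫ x, ‖Literature.Analysis.FluidPDE.curl (v n) x‖ ^ 2) = 1) →
      (∀ n, (∫ x, Literature.Analysis.FluidPDE.frobeniusNormSq (fderiv ℝ (Literature.Analysis.FluidPDE.curl (v n)) x)) = 1) →
      Tendsto (fun n => ∫ x, ⟪Literature.Analysis.FluidPDE.curl (v n) x, fderiv ℝ (v n) x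
        (Literature.Analysis.FluidPDE.curl (v n) x)⟫_ℝ) atTop (𝓝 c) →
      (∀ᶠ n in atTop, δ ≤ ∫ x in Metric.ball (0 : EuclideanSpace ℝ (Fin 3)) K, ‖Literature.Analysis.FluidPDE.curl (v n) x‖ ^ 2) →
      ∃ w : EuclideanSpace ℝ (Fin 3) → EuclideanSpace ℝ (Fin 3), (ContDiff ℝ (⊤ : ℕ∞) w ∧
        Literature.Analysis.FluidPDE.VectorCalculus.IsDivFree w ∧ (∫⁻ x, ‖iteratedFDeriv ℝ 0 w x‖ₑ ^ 2 < ⊤) ∧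
        (∫⁻ x, ‖iteratedFDeriv ℝ 1 w x‖ₑ ^ 2 < ⊤) ∧ (∫⁻ x, ‖iteratedFDeriv ℝ 2 w x‖ₑ ^ 2 < ⊤)) ∧
        0 < (∫ x, ‖Literature.Analysis.FluidPDE.curl w x‖ ^ 2) ∧
        ∃ (a : ℕ → EuclideanSpace ℝ (Fin 3)) (φ : ℕ → ℕ), StrictMono φ ∧
        Tendsto (fun k => ∫ x, ‖Literature.Analysis.FluidPDE.curl ((fun x => v (φ k) (x - a k)) - w) x‖ ^ 2) atTop
          (𝓝 (1 - ∫ x, ‖Literature.Analysis.FluidPDE.curl w x‖ ^ 2)) ∧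
        Tendsto (fun k => ∫ x, Literature.Analysis.FluidPDE.frobeniusNormSq (fderiv ℝ
          (Literature.Analysis.FluidPDE.curl ((fun x => v (φ k) (x - a k)) - w)) x)) atTop
          (𝓝 (1 - ∫ x, Literature.Analysis.FluidPDE.frobeniusNormSq (fderiv ℝ (Literature.Analysis.FluidPDE.curl w) x))) ∧
        Tendsto (fun k => ∫ x, ⟪Literature.Analysis.FluidPDE.curl ((fun x => v (φ k) (x - a k)) - w) x,
          fderiv ℝ ((fun x => v (φ k) (x - a k)) - w) x
          (Literature.Analysis.FluidPDE.curl ((fun x => v (φ k) (x - a k)) - w) x)⟫_ℝ) atTop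
          (𝓝 (c - ∫ x, ⟪Literature.Analysis.FluidPDE.curl w x, fderiv ℝ w x (Literature.Analysis.FluidPDE.curl w x)⟫_ℝ))) :
    ∀ v : ℕ → EuclideanSpace ℝ (Fin 3) → EuclideanSpace ℝ (Fin 3), (∀ n, ContDiff ℝ (⊤ : ℕ∞) (v n) ∧
      Literature.Analysis.FluidPDE.VectorCalculus.IsDivFree (v n) ∧ (∫⁻ x, ‖iteratedFDeriv ℝ 0 (v n) x‖ₑ ^ 2 < ⊤) ∧
      (∫⁻ x, ‖iteratedFDeriv ℝ 1 (v n) x‖ₑ ^ 2 < ⊤) ∧ (∫⁻ x, ‖iteratedFDeriv ℝ 2 (v n) x‖ₑ ^ 2 < ⊤)) →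
      (∀ n, (∫ x, ‖Literature.Analysis.FluidPDE.curl (v n) x‖ ^ 2) = 1) →
      (∀ n, (∫ x, Literature.Analysis.FluidPDE.frobeniusNormSq (fderiv ℝ (Literature.Analysis.FluidPDE.curl (v n)) x)) = 1) →
      Tendsto (fun n => ∫ x, ⟪Literature.Analysis.FluidPDE.curl (v n) x, fderiv ℝ (v n) x
        (Literature.Analysis.FluidPDE.curl (v n) x)⟫_ℝ) atTop (𝓝 c) →
      ∃ w : EuclideanSpace ℝ (Fin 3) → EuclideanSpace ℝ (Fin 3), (ContDiff ℝ (⊤ : ℕ∞) w ∧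
        Literature.Analysis.FluidPDE.VectorCalculus.IsDivFree w ∧ (∫⁻ x, ‖iteratedFDeriv ℝ 0 w x‖ₑ ^ 2 < ⊤) ∧
        (∫⁻ x, ‖iteratedFDeriv ℝ 1 w x‖ₑ ^ 2 < ⊤) ∧ (∫⁻ x, ‖iteratedFDeriv ℝ 2 w x‖ₑ ^ 2 < ⊤)) ∧
        ∃ (a : ℕ → EuclideanSpace ℝ (Fin 3)) (φ : ℕ → ℕ), StrictMono φ ∧
        Tendsto (fun k => ∫ x, ‖Literature.Analysis.FluidPDE.curl ((fun x => v (φ k) (x - a k)) - w) x‖ ^ 2) atTop (𝓝 0) ∧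
        Tendsto (fun k => ∫ x, Literature.Analysis.FluidPDE.frobeniusNormSq (fderiv ℝ
          (Literature.Analysis.FluidPDE.curl ((fun x => v (φ k) (x - a k)) - w)) x)) atTop (𝓝 0) := by
  obtain ⟨K, δ, hK, hδ, hcen⟩ := exists_centres_of_maximising hc
  refine compact_of_weakProfile hc hadm fun v hAdm hZ1 hP1 hS => ?_
  -- centre the sequence: `u n = v n (· − a n)` is admissible, normalised, maximising and centred
  obtain ⟨a, ha⟩ := hcen v hAdm hZ1 hP1 hS
  have huAdm : ∀ n, ContDiff ℝ (⊤ : ℕ∞) (fun x => v n (x - a n)) ∧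
      VectorCalculus.IsDivFree (fun x => v n (x - a n)) ∧
      (∫⁻ x, ‖iteratedFDeriv ℝ 0 (fun x => v n (x - a n)) x‖ₑ ^ 2 < ⊤) ∧
      (∫⁻ x, ‖iteratedFDeriv ℝ 1 (fun x => v n (x - a n)) x‖ₑ ^ 2 < ⊤) ∧
      (∫⁻ x, ‖iteratedFDeriv ℝ 2 (fun x => v n (x - a n)) x‖ₑ ^ 2 < ⊤) := fun n => admissible_translate (hAdm n) (a n)
  have huZ : ∀ n, (∫ x, ‖curl (fun x => v n (x - a n)) x‖ ^ 2) = 1 := fun n =>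
    (functionals_translate (v n) (a n)).1.trans (hZ1 n)
  have huP : ∀ n, (∫ x, frobeniusNormSq (fderiv ℝ (curl (fun x => v n (x - a n))) x)) = 1 := fun n =>
    (functionals_translate (v n) (a n)).2.1.trans (hP1 n)
  have huS : Tendsto (fun n => ∫ x, ⟪curl (fun x => v n (x - a n)) x, fderiv ℝ (fun x => v n (x - a n)) x
      (curl (fun x => v n (x - a n)) x)⟫_ℝ) atTop (𝓝 c) :=
    hS.congr fun n => ((functionals_translate (v n) (a n)).2.2).symm
  obtain ⟨w, hw, hZw0, b, φ, hφ, hZ, hP, hSspl⟩ := HWc K δ hK hδ (fun n => fun x => v n (x - a n)) huAdm huZ huP huS ha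
  refine ⟨w, hw, hZw0, fun k => b k + a (φ k), φ, hφ, ?_, ?_, ?_⟩
  · refine hZ.congr fun k => ?_
    rw [translate_translate (v (φ k)) (a (φ k)) (b k)]
  · refine hP.congr fun k => ?_
    rw [translate_translate (v (φ k)) (a (φ k)) (b k)]
  · refine hSspl.congr fun k => ?_
    rw [translate_translate (v (φ k)) (a (φ k)) (b k)]

/-! ## §6 Non-vanishing of the limit from LOCAL convergence on the centring ball -/

/-- `∫‖g‖² dμ = ‖g‖²_{L²(μ)}` for `g ∈ L²(μ)` (plumbing, any measure). [folklore] -/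
theorem integral_norm_sq_eq_of_memLp' {μ : Measure (EuclideanSpace ℝ (Fin 3))}
    {g : EuclideanSpace ℝ (Fin 3) → EuclideanSpace ℝ (Fin 3)} (hg : MemLp g 2 μ) :
    ∫ x, ‖g x‖ ^ 2 ∂μ = ((eLpNorm g 2 μ).toReal) ^ 2 := by
  have hint : Integrable (fun x => ‖g x‖ ^ 2) μ := (memLp_two_iff_integrable_sq_norm hg.1).1 hg
  rw [integral_eq_lintegral_of_nonneg_ae (Eventually.of_forall fun x => by positivity) hint.aestronglyMeasurable]
  have h : ∫⁻ x, ENNReal.ofReal (‖g x‖ ^ 2) ∂μ = ∫⁻ x, ‖g x‖ₑ ^ 2 ∂μ :=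
    lintegral_congr fun x => by rw [ENNReal.ofReal_pow (norm_nonneg _), ofReal_norm]
  have h2 : ∫⁻ x, ‖g x‖ₑ ^ 2 ∂μ = eLpNorm g 2 μ ^ 2 := by
    have h' := eLpNorm_nnreal_pow_eq_lintegral (f := g) (μ := μ) (p := (2 : NNReal)) two_ne_zero
    simp only [ENNReal.coe_ofNat, NNReal.coe_ofNat, ENNReal.rpow_two] at h'
    exact h'.symm
  rw [h, h2, ENNReal.toReal_pow]

/-- **Local triangle inequality for vorticities**: on any measurable set `B`,
`√(∫_B |curl f|²) ≤ √(∫_B |curl (f − w)|²) + √(∫_B |curl w|²)` for `C^∞` fields with `D¹ ∈ L²`. [folklore] -/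
theorem sqrt_setIntegral_curl_sq_le {f w : EuclideanSpace ℝ (Fin 3) → EuclideanSpace ℝ (Fin 3)}
    (hf : ContDiff ℝ (⊤ : ℕ∞) f) (hf1 : ∫⁻ x, ‖iteratedFDeriv ℝ 1 f x‖ₑ ^ 2 < ⊤)
    (hw : ContDiff ℝ (⊤ : ℕ∞) w) (hw1 : ∫⁻ x, ‖iteratedFDeriv ℝ 1 w x‖ₑ ^ 2 < ⊤) (B : Set (EuclideanSpace ℝ (Fin 3))) :
    Real.sqrt (∫ x in B, ‖curl f x‖ ^ 2) ≤
      Real.sqrt (∫ x in B, ‖curl (f - w) x‖ ^ 2) + Real.sqrt (∫ x in B, ‖curl w x‖ ^ 2) := by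
  have mf : MemLp (curl f) 2 (volume.restrict B) := (RigidExit.ReferenceFlow.memLp_two_curl hf hf1).restrict B
  have mw : MemLp (curl w) 2 (volume.restrict B) := (RigidExit.ReferenceFlow.memLp_two_curl hw hw1).restrict B
  have hcurl_sub : curl (f - w) = curl f - curl w := by
    funext x
    rw [show f - w = fun y => f y - w y from rfl]
    exact curl_sub (hf.differentiable (by norm_cast) x) (hw.differentiable (by norm_cast) x)
  have mfw : MemLp (curl (f - w)) 2 (volume.restrict B) := by rw [hcurl_sub]; exact mf.sub mw
  rw [integral_norm_sq_eq_of_memLp' mf, integral_norm_sq_eq_of_memLp' mw, integral_norm_sq_eq_of_memLp' mfw,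
    Real.sqrt_sq ENNReal.toReal_nonneg, Real.sqrt_sq ENNReal.toReal_nonneg, Real.sqrt_sq ENNReal.toReal_nonneg,
    hcurl_sub]
  have hne2 : eLpNorm (curl w) 2 (volume.restrict B) ≠ ⊤ := mw.eLpNorm_ne_top
  have hne3 : eLpNorm (curl f - curl w) 2 (volume.restrict B) ≠ ⊤ := (mf.sub mw).eLpNorm_ne_top
  have h := eLpNorm_add_le (μ := volume.restrict B) (mf.1.sub mw.1) mw.1 (by norm_num : (1 : ℝ≥0∞) ≤ 2)
  rw [sub_add_cancel] at h
  have h' := ENNReal.toReal_mono (ENNReal.add_ne_top.2 ⟨hne3, hne2⟩) h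
  rwa [ENNReal.toReal_add hne3 hne2] at h'

/-- **NON-VANISHING OF THE LIMIT, proved.** If the fields `u_k` are centred (eventually `δ ≤ ∫_{B(0,K)} |curl u_k|²`,
`δ > 0`) and converge to `w` LOCALLY on the centring ball (`∫_{B(0,K)} |curl (u_k − w)|² → 0` — what Rellich's theorem
gives from `Pal(u_k) = 1` after passing to a subsequence), then the limit carries enstrophy: `δ ≤ ∫_{B(0,K)} |curl w|²`, in
particular `0 < Z(w)`. [folklore] -/
theorem enstrophy_pos_of_centred_localLimit {u : ℕ → EuclideanSpace ℝ (Fin 3) → EuclideanSpace ℝ (Fin 3)}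
    {w : EuclideanSpace ℝ (Fin 3) → EuclideanSpace ℝ (Fin 3)} {K δ : ℝ}
    (hu : ∀ k, ContDiff ℝ (⊤ : ℕ∞) (u k)) (hu1 : ∀ k, ∫⁻ x, ‖iteratedFDeriv ℝ 1 (u k) x‖ₑ ^ 2 < ⊤)
    (hw : ContDiff ℝ (⊤ : ℕ∞) w) (hw1 : ∫⁻ x, ‖iteratedFDeriv ℝ 1 w x‖ₑ ^ 2 < ⊤) (hδ : 0 < δ)
    (hcen : ∀ᶠ k in atTop, δ ≤ ∫ x in Metric.ball (0 : EuclideanSpace ℝ (Fin 3)) K, ‖curl (u k) x‖ ^ 2)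
    (hloc : Tendsto (fun k => ∫ x in Metric.ball (0 : EuclideanSpace ℝ (Fin 3)) K, ‖curl (u k - w) x‖ ^ 2) atTop (𝓝 0)) :
    δ ≤ (∫ x in Metric.ball (0 : EuclideanSpace ℝ (Fin 3)) K, ‖curl w x‖ ^ 2) ∧ 0 < ∫ x, ‖curl w x‖ ^ 2 := by
  set B : Set (EuclideanSpace ℝ (Fin 3)) := Metric.ball 0 K with hB
  set ZB : ℝ := ∫ x in B, ‖curl w x‖ ^ 2 with hZB
  have hev : ∀ᶠ k in atTop, Real.sqrt δ ≤ Real.sqrt (∫ x in B, ‖curl (u k - w) x‖ ^ 2) + Real.sqrt ZB :=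
    hcen.mono fun k hk => (Real.sqrt_le_sqrt hk).trans (sqrt_setIntegral_curl_sq_le (hu k) (hu1 k) hw hw1 B)
  have hlim : Tendsto (fun k => Real.sqrt (∫ x in B, ‖curl (u k - w) x‖ ^ 2) + Real.sqrt ZB) atTop
      (𝓝 (Real.sqrt ZB)) := by
    have h := hloc.sqrt.add_const (Real.sqrt ZB)
    rwa [Real.sqrt_zero, zero_add] at h
  have hsqrt : Real.sqrt δ ≤ Real.sqrt ZB := ge_of_tendsto hlim hev
  have hZB0 : 0 ≤ ZB := integral_nonneg fun x => by positivity
  have hδB : δ ≤ ZB := (Real.sqrt_le_sqrt_iff hZB0).1 hsqrt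
  refine ⟨hδB, lt_of_lt_of_le (lt_of_lt_of_le hδ hδB) ?_⟩
  exact setIntegral_le_integral (integrable_norm_curl_sq (hw.of_le (by norm_cast)) hw1).1
    (Eventually.of_forall fun x => by positivity)

/-- Translating by `0` is the identity (plumbing). [folklore] -/
theorem translate_zero (u : EuclideanSpace ℝ (Fin 3) → EuclideanSpace ℝ (Fin 3)) : (fun x => u (x - 0)) = u := by
  funext x
  rw [sub_zero]

/-- **COMPACTNESS from LOCAL weak profiles of centred sequences.** The hypothesis `HWc` of `compact_of_centredWeakProfile`
with its non-vanishing clause `0 < Z(w)` REPLACED by local convergence on the centring ball and no further translation: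
for all `K, δ > 0`, every centred admissible sequence with `Z = Pal = 1`, `S → c` has a subsequence `φ` and an admissible `w`
with `∫_{B(0,K)} |curl (v_{φ k} − w)|² → 0`, `Z(v_{φ k} − w) → 1 − Z(w)`, `Pal(v_{φ k} − w) → 1 − Pal(w)`,
`S(v_{φ k} − w) → c − S(w)`. Then COMPACTNESS at `c` holds (`c > 0` admissible): non-vanishing of `w` is
`enstrophy_pos_of_centred_localLimit`. [folklore] -/
theorem compact_of_centredLocalProfile {c : ℝ} (hc : 0 < c)
    (hadm : ∀ f : EuclideanSpace ℝ (Fin 3) → EuclideanSpace ℝ (Fin 3), (ContDiff ℝ (⊤ : ℕ∞) f ∧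
      Literature.Analysis.FluidPDE.VectorCalculus.IsDivFree f ∧ (∫⁻ x, ‖iteratedFDeriv ℝ 0 f x‖ₑ ^ 2 < ⊤) ∧
      (∫⁻ x, ‖iteratedFDeriv ℝ 1 f x‖ₑ ^ 2 < ⊤) ∧ (∫⁻ x, ‖iteratedFDeriv ℝ 2 f x‖ₑ ^ 2 < ⊤)) → (∫ x,
      ⟪Literature.Analysis.FluidPDE.curl f x, fderiv ℝ f x (Literature.Analysis.FluidPDE.curl f x)⟫_ℝ) ≤ c *
      (∫ x, ‖Literature.Analysis.FluidPDE.curl f x‖ ^ 2) ^ (3 / 4 : ℝ) * (∫ x,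
      Literature.Analysis.FluidPDE.frobeniusNormSq (fderiv ℝ (Literature.Analysis.FluidPDE.curl f) x)) ^ (3 / 4 : ℝ))
    (HWloc : ∀ K δ : ℝ, 0 < K → 0 < δ → ∀ v : ℕ → EuclideanSpace ℝ (Fin 3) → EuclideanSpace ℝ (Fin 3),
      (∀ n, ContDiff ℝ (⊤ : ℕ∞) (v n) ∧
      Literature.Analysis.FluidPDE.VectorCalculus.IsDivFree (v n) ∧ (∫⁻ x, ‖iteratedFDeriv ℝ 0 (v n) x‖ₑ ^ 2 < ⊤) ∧
      (∫⁻ x, ‖iteratedFDeriv ℝ 1 (v n) x‖ₑ ^ 2 < ⊤) ∧ (∫⁻ x, ‖iteratedFDeriv ℝ 2 (v n) x‖ₑ ^ 2 < ⊤)) →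
      (∀ n, (∫ x, ‖Literature.Analysis.FluidPDE.curl (v n) x‖ ^ 2) = 1) →
      (∀ n, (∫ x, Literature.Analysis.FluidPDE.frobeniusNormSq (fderiv ℝ (Literature.Analysis.FluidPDE.curl (v n)) x)) = 1) →
      Tendsto (fun n => ∫ x, ⟪Literature.Analysis.FluidPDE.curl (v n) x, fderiv ℝ (v n) x
        (Literature.Analysis.FluidPDE.curl (v n) x)⟫_ℝ) atTop (𝓝 c) →
      (∀ᶠ n in atTop, δ ≤ ∫ x in Metric.ball (0 : EuclideanSpace ℝ (Fin 3)) K, ‖Literature.Analysis.FluidPDE.curl (v n) x‖ ^ 2) →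
      ∃ w : EuclideanSpace ℝ (Fin 3) → EuclideanSpace ℝ (Fin 3), (ContDiff ℝ (⊤ : ℕ∞) w ∧
        Literature.Analysis.FluidPDE.VectorCalculus.IsDivFree w ∧ (∫⁻ x, ‖iteratedFDeriv ℝ 0 w x‖ₑ ^ 2 < ⊤) ∧
        (∫⁻ x, ‖iteratedFDeriv ℝ 1 w x‖ₑ ^ 2 < ⊤) ∧ (∫⁻ x, ‖iteratedFDeriv ℝ 2 w x‖ₑ ^ 2 < ⊤)) ∧
        ∃ φ : ℕ → ℕ, StrictMono φ ∧
        Tendsto (fun k => ∫ x in Metric.ball (0 : EuclideanSpace ℝ (Fin 3)) K,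
          ‖Literature.Analysis.FluidPDE.curl (v (φ k) - w) x‖ ^ 2) atTop (𝓝 0) ∧
        Tendsto (fun k => ∫ x, ‖Literature.Analysis.FluidPDE.curl (v (φ k) - w) x‖ ^ 2) atTop
          (𝓝 (1 - ∫ x, ‖Literature.Analysis.FluidPDE.curl w x‖ ^ 2)) ∧
        Tendsto (fun k => ∫ x, Literature.Analysis.FluidPDE.frobeniusNormSq (fderiv ℝ
          (Literature.Analysis.FluidPDE.curl (v (φ k) - w)) x)) atTop
          (𝓝 (1 - ∫ x, Literature.Analysis.FluidPDE.frobeniusNormSq (fderiv ℝ (Literature.Analysis.FluidPDE.curl w) x))) ∧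
        Tendsto (fun k => ∫ x, ⟪Literature.Analysis.FluidPDE.curl (v (φ k) - w) x, fderiv ℝ (v (φ k) - w) x
          (Literature.Analysis.FluidPDE.curl (v (φ k) - w) x)⟫_ℝ) atTop
          (𝓝 (c - ∫ x, ⟪Literature.Analysis.FluidPDE.curl w x, fderiv ℝ w x (Literature.Analysis.FluidPDE.curl w x)⟫_ℝ))) :
    ∀ v : ℕ → EuclideanSpace ℝ (Fin 3) → EuclideanSpace ℝ (Fin 3), (∀ n, ContDiff ℝ (⊤ : ℕ∞) (v n) ∧
      Literature.Analysis.FluidPDE.VectorCalculus.IsDivFree (v n) ∧ (∫⁻ x, ‖iteratedFDeriv ℝ 0 (v n) x‖ₑ ^ 2 < ⊤) ∧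
      (∫⁻ x, ‖iteratedFDeriv ℝ 1 (v n) x‖ₑ ^ 2 < ⊤) ∧ (∫⁻ x, ‖iteratedFDeriv ℝ 2 (v n) x‖ₑ ^ 2 < ⊤)) →
      (∀ n, (∫ x, ‖Literature.Analysis.FluidPDE.curl (v n) x‖ ^ 2) = 1) →
      (∀ n, (∫ x, Literature.Analysis.FluidPDE.frobeniusNormSq (fderiv ℝ (Literature.Analysis.FluidPDE.curl (v n)) x)) = 1) →
      Tendsto (fun n => ∫ x, ⟪Literature.Analysis.FluidPDE.curl (v n) x, fderiv ℝ (v n) x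
        (Literature.Analysis.FluidPDE.curl (v n) x)⟫_ℝ) atTop (𝓝 c) →
      ∃ w : EuclideanSpace ℝ (Fin 3) → EuclideanSpace ℝ (Fin 3), (ContDiff ℝ (⊤ : ℕ∞) w ∧
        Literature.Analysis.FluidPDE.VectorCalculus.IsDivFree w ∧ (∫⁻ x, ‖iteratedFDeriv ℝ 0 w x‖ₑ ^ 2 < ⊤) ∧
        (∫⁻ x, ‖iteratedFDeriv ℝ 1 w x‖ₑ ^ 2 < ⊤) ∧ (∫⁻ x, ‖iteratedFDeriv ℝ 2 w x‖ₑ ^ 2 < ⊤)) ∧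
        ∃ (a : ℕ → EuclideanSpace ℝ (Fin 3)) (φ : ℕ → ℕ), StrictMono φ ∧
        Tendsto (fun k => ∫ x, ‖Literature.Analysis.FluidPDE.curl ((fun x => v (φ k) (x - a k)) - w) x‖ ^ 2) atTop (𝓝 0) ∧
        Tendsto (fun k => ∫ x, Literature.Analysis.FluidPDE.frobeniusNormSq (fderiv ℝ
          (Literature.Analysis.FluidPDE.curl ((fun x => v (φ k) (x - a k)) - w)) x)) atTop (𝓝 0) := by
  refine compact_of_centredWeakProfile hc hadm fun K δ hK hδ v hAdm hZ1 hP1 hS hcen => ?_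
  obtain ⟨w, hw, φ, hφ, hloc, hZ, hP, hSspl⟩ := HWloc K δ hK hδ v hAdm hZ1 hP1 hS hcen
  -- the subsequence is still centred; local convergence makes the limit nonzero
  have hcen' : ∀ᶠ k in atTop, δ ≤ ∫ x in Metric.ball (0 : EuclideanSpace ℝ (Fin 3)) K, ‖curl (v (φ k)) x‖ ^ 2 :=
    hφ.tendsto_atTop.eventually hcen
  have hpos := (enstrophy_pos_of_centred_localLimit (fun k => (hAdm (φ k)).1) (fun k => (hAdm (φ k)).2.2.2.1) hw.1
    hw.2.2.2.1 hδ hcen' hloc).2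
  refine ⟨w, hw, hpos, fun _ => 0, φ, hφ, ?_, ?_, ?_⟩
  · exact hZ.congr fun k => by rw [translate_zero (v (φ k))]
  · exact hP.congr fun k => by rw [translate_zero (v (φ k))]
  · exact hSspl.congr fun k => by rw [translate_zero (v (φ k))]

/-- **`NearSaturationNearMaximiser` (stmt-25482) from LOCAL weak profiles of centred sequences, BY NAME.** What is assumed
is exactly the middle move (P) of the concentration-compactness step for the Lu–Doering functional — for centred
normalised maximising sequences: a subsequence and an ADMISSIBLE limit with local `L²`-convergence of the vorticity on the
centring ball (Rellich), asymptotic Pythagoras for `Z`, `Pal` (weak convergence) and splitting of `S` (Brezis–Lieb);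
non-vanishing (N) and the upgrade (U) are proved (`…SeqCoreUpgrade`, this file). NOT proved here: (P). [folklore] -/
theorem nearSaturationNearMaximiser_of_centredLocalProfile
    (HWloc : ∀ c : ℝ, (0 < c ∧ (∀ v : EuclideanSpace ℝ (Fin 3) → EuclideanSpace ℝ (Fin 3), (ContDiff ℝ (⊤ : ℕ∞) v ∧
      Literature.Analysis.FluidPDE.VectorCalculus.IsDivFree v ∧ (∫⁻ x, ‖iteratedFDeriv ℝ 0 v x‖ₑ ^ 2 < ⊤) ∧
      (∫⁻ x, ‖iteratedFDeriv ℝ 1 v x‖ₑ ^ 2 < ⊤) ∧ (∫⁻ x, ‖iteratedFDeriv ℝ 2 v x‖ₑ ^ 2 < ⊤)) → (∫ x,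
      ⟪Literature.Analysis.FluidPDE.curl v x, fderiv ℝ v x (Literature.Analysis.FluidPDE.curl v x)⟫_ℝ) ≤ c *
      (∫ x, ‖Literature.Analysis.FluidPDE.curl v x‖ ^ 2) ^ (3 / 4 : ℝ) * (∫ x,
      Literature.Analysis.FluidPDE.frobeniusNormSq (fderiv ℝ (Literature.Analysis.FluidPDE.curl v) x)) ^ (3 /
      4 : ℝ)) ∧ ∀ c' : ℝ, (∀ w : EuclideanSpace ℝ (Fin 3) → EuclideanSpace ℝ (Fin 3), (ContDiff ℝ (⊤ : ℕ∞) w ∧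
      Literature.Analysis.FluidPDE.VectorCalculus.IsDivFree w ∧ (∫⁻ x, ‖iteratedFDeriv ℝ 0 w x‖ₑ ^ 2 < ⊤) ∧
      (∫⁻ x, ‖iteratedFDeriv ℝ 1 w x‖ₑ ^ 2 < ⊤) ∧ (∫⁻ x, ‖iteratedFDeriv ℝ 2 w x‖ₑ ^ 2 < ⊤)) → (∫ x,
      ⟪Literature.Analysis.FluidPDE.curl w x, fderiv ℝ w x (Literature.Analysis.FluidPDE.curl w x)⟫_ℝ) ≤ c' *
      (∫ x, ‖Literature.Analysis.FluidPDE.curl w x‖ ^ 2) ^ (3 / 4 : ℝ) * (∫ x,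
      Literature.Analysis.FluidPDE.frobeniusNormSq (fderiv ℝ (Literature.Analysis.FluidPDE.curl w) x)) ^ (3 /
      4 : ℝ)) → c ≤ c') →
      ∀ K δ : ℝ, 0 < K → 0 < δ → ∀ v : ℕ → EuclideanSpace ℝ (Fin 3) → EuclideanSpace ℝ (Fin 3),
      (∀ n, ContDiff ℝ (⊤ : ℕ∞) (v n) ∧
      Literature.Analysis.FluidPDE.VectorCalculus.IsDivFree (v n) ∧ (∫⁻ x, ‖iteratedFDeriv ℝ 0 (v n) x‖ₑ ^ 2 < ⊤) ∧
      (∫⁻ x, ‖iteratedFDeriv ℝ 1 (v n) x‖ₑ ^ 2 < ⊤) ∧ (∫⁻ x, ‖iteratedFDeriv ℝ 2 (v n) x‖ₑ ^ 2 < ⊤)) →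
      (∀ n, (∫ x, ‖Literature.Analysis.FluidPDE.curl (v n) x‖ ^ 2) = 1) →
      (∀ n, (∫ x, Literature.Analysis.FluidPDE.frobeniusNormSq (fderiv ℝ (Literature.Analysis.FluidPDE.curl (v n)) x)) = 1) →
      Tendsto (fun n => ∫ x, ⟪Literature.Analysis.FluidPDE.curl (v n) x, fderiv ℝ (v n) x
        (Literature.Analysis.FluidPDE.curl (v n) x)⟫_ℝ) atTop (𝓝 c) →
      (∀ᶠ n in atTop, δ ≤ ∫ x in Metric.ball (0 : EuclideanSpace ℝ (Fin 3)) K, ‖Literature.Analysis.FluidPDE.curl (v n) x‖ ^ 2) →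
      ∃ w : EuclideanSpace ℝ (Fin 3) → EuclideanSpace ℝ (Fin 3), (ContDiff ℝ (⊤ : ℕ∞) w ∧
        Literature.Analysis.FluidPDE.VectorCalculus.IsDivFree w ∧ (∫⁻ x, ‖iteratedFDeriv ℝ 0 w x‖ₑ ^ 2 < ⊤) ∧
        (∫⁻ x, ‖iteratedFDeriv ℝ 1 w x‖ₑ ^ 2 < ⊤) ∧ (∫⁻ x, ‖iteratedFDeriv ℝ 2 w x‖ₑ ^ 2 < ⊤)) ∧
        ∃ φ : ℕ → ℕ, StrictMono φ ∧
        Tendsto (fun k => ∫ x in Metric.ball (0 : EuclideanSpace ℝ (Fin 3)) K,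
          ‖Literature.Analysis.FluidPDE.curl (v (φ k) - w) x‖ ^ 2) atTop (𝓝 0) ∧
        Tendsto (fun k => ∫ x, ‖Literature.Analysis.FluidPDE.curl (v (φ k) - w) x‖ ^ 2) atTop
          (𝓝 (1 - ∫ x, ‖Literature.Analysis.FluidPDE.curl w x‖ ^ 2)) ∧
        Tendsto (fun k => ∫ x, Literature.Analysis.FluidPDE.frobeniusNormSq (fderiv ℝ
          (Literature.Analysis.FluidPDE.curl (v (φ k) - w)) x)) atTop
          (𝓝 (1 - ∫ x, Literature.Analysis.FluidPDE.frobeniusNormSq (fderiv ℝ (Literature.Analysis.FluidPDE.curl w) x))) ∧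
        Tendsto (fun k => ∫ x, ⟪Literature.Analysis.FluidPDE.curl (v (φ k) - w) x, fderiv ℝ (v (φ k) - w) x
          (Literature.Analysis.FluidPDE.curl (v (φ k) - w) x)⟫_ℝ) atTop
          (𝓝 (c - ∫ x, ⟪Literature.Analysis.FluidPDE.curl w x, fderiv ℝ w x (Literature.Analysis.FluidPDE.curl w x)⟫_ℝ))) :
    Summit.NavierStokesRegularity.NavierStokesRegularity.Theses.EfficiencyFloor.NearSaturationNearMaximiser :=
  nearSaturationNearMaximiser_of_compact fun c hsharp =>
    compact_of_centredLocalProfile hsharp.1 (fun f hf => hsharp.2.1 f hf) (HWloc c hsharp)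

end SeqCore

end NearSaturationNearMaximiser

end Summit.NavierStokesRegularity.NavierStokesRegularity.Theorems

end
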